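import Mathlib.Topology.Connected.PathConnected
import Mathlib.Topology.Connected.LocallyPathConnected
import Mathlib.Topology.Connected.Clopen
import Mathlib.Topology.Separation.Regular
import Mathlib.Analysis.SpecificLimits.Basic
import Mathlib.Analysis.InnerProductSpace.PiL2
import Mathlib.Analysis.Normed.Module.Connected
import Mathlib.Analysis.Convex.PathConnected
import Literature.Topology.FourManifolds.Morse
import Literature.Topology.FourManifolds.MorseProofs
import Literature.Topology.FourManifolds.MorseLemma
import Literature.Topology.FourManifolds.RegularLevelSet
import Literature.Topology.FourManifolds.LickorishWallace
import HarnessLib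

/-!
# The boundary of a handlebody is connected (proof of F2a of `LickorishWallace.lean`)

Topic `Literature/Topology/FourManifolds`; discharges the named fact
`Literature.Topology.FourManifolds.IsHandlebody.connectedSpace_boundary` (`LickorishWallace.lean`, step **F2a** of the
decomposition of the Lickorish–Wallace theorem): *for a genus-`g` handlebody `H`
(`Literature.IsHandlebody g H`) and any boundary datum `b` of `H`, the boundary surface
`b.carrier ≅ ∂H` is connected (and nonempty)* — Juhász, *Differential and Low-Dimensional
Topology* (2023), §3.5, p. 96 ("a genus `g` handlebody is a three-ball with `g` oriented
one-handles attached") and Def. 3.27 (the Heegaard surface `Σ = ∂H_α` is "a closed, connected,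
and oriented surface");
Schultens, *Introduction to 3-Manifolds* (2014), Def. 6.1.5. Everything in this file is
**proved**: `Literature.Topology.FourManifolds.IsHandlebody.connectedSpace_boundary_holds`.

## The statement being proved

`Literature.IsHandlebody g H` says that `H` is compact, connected, orientable and carries a Morse
function `f` adapted to the boundary (`Literature.IsMorseAdapted (𝓡∂ 3) f`: `f ≡ 1` and regular on
`∂H`, `f < 1` inside; Milnor, *Lectures on the h-cobordism theorem* (1965), Def. 3.1 with
`V₀ = ∅`) with exactly one critical point of index `0`, `g` of index `1` and none of index `2`
or `3` (`Literature.HasHandleDecomposition 2 H (handleCount 1 g)`; the counts are honest because the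
critical set of a Morse function on a compact manifold is finite,
`Literature.Topology.FourManifolds.IsMorse.finite_criticalSet_holds`). A boundary datum
`b : Literature.BoundaryData (𝓡∂ 3) H (𝓡 2)` is a surface `b.carrier` with an embedding `b.incl`
onto `(𝓡∂ 3).boundary H = f⁻¹(1)`. So the claim is: **the top level `f⁻¹(1)` of such an
`f` is connected and nonempty.** Classically this is read off the dual handle decomposition: `H` is
`∂H × [0, 1]` with the handles of `1 - f` attached, of index `3 - λ ≥ 2`, whose attaching
spheres are connected, so `π₀(∂H) → π₀(H)` is a bijection (Milnor, *Morse theory* (1963),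
Thms. 3.1–3.2 and Remark 3.3; Juhász 2023, §1.5, pp. 26–27 and §1.6, p. 31: "when we pass a
critical point of index `i` ... the level set changes by a surgery"). Neither the regular
interval theorem nor handle attachment is available in the tree or in Mathlib; the proof below
is an elementary substitute that uses only the *local* normal forms, both of which are proved
in the tree: the Morse lemma at interior critical points
(`Literature.Topology.FourManifolds.IsMorse.exists_chart_eq_quadratic_of_isInteriorPoint`, `MorseLemma.lean`) and the
straightening of a function at an interior regular point (`Literature.Topology.FourManifolds.exists_sliceChart`,
`RegularLevelSet.lean`).

## Proof

* **Topology** (`Literature.Topology.FourManifolds.isPreconnected_preimage_top_of_joinedIn`). Let `X` be compact, connected,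
  Hausdorff and locally path connected, `f : X → ℝ` continuous with `f ≤ a`, and suppose every
  `x` with `f x < a` (i) adheres to `{f > f x}` and (ii) has arbitrarily small neighbourhoods
  `U` such that any two points of `U ∩ {f > f x}` are joined by a path inside `{f > f x}`.
  Then `f⁻¹(a)` is preconnected. *Proof.* If `f⁻¹(a) = A ⊔ B` splits, separate `A`, `B` by
  disjoint open sets; for `c ≤ a` let `C(c)` be the connected component of a fixed `a₀ ∈ A` in
  `{f ≥ c}` and `T = {c | C(c) ∩ B ≠ ∅}`, a lower set containing `min f` (here connectedness
  of `X` enters) and bounded away from `a` (by compactness `{f ≥ c₀}` lies in the two separating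
  open sets for some `c₀ < a`). Its supremum `c*` lies in `T`: the `C(c* - 1/(n+1))` are
  decreasing continua meeting the compact set `B`, and a decreasing intersection of continua is
  a continuum (`Literature.Topology.FourManifolds.isPreconnected_iInter_of_antitone`). At the level `c*` a chain argument
  along the continuum `C(c*)` (`IsPreconnected.induction₂'`, using (ii) at the points of
  `C(c*)` on the level, local path connectedness above it, and (i) to pass between consecutive
  neighbourhoods) joins `a₀` to a point of `B` by a *path inside `{f > c*}`*; the path is
  compact, hence lies in `{f ≥ c}` for some `c > c*`, so `c ∈ T` — contradicting `c* = sup T`.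
* **Local pictures.** (ii) and (i) hold at an interior regular point
  (`Literature.Topology.FourManifolds.localJoin_of_not_isMCriticalPt`: in a slice chart `f - f x` is a coordinate, and a
  half ball is convex) and at an interior critical point of index `λ` with `λ + 2 ≤ dim`
  (`Literature.Topology.FourManifolds.localJoin_of_isMCriticalPt`: in a Morse chart `f - f x = -|u|² + |v|²` with
  `dim v ≥ 2`, and `{|v| > |u|}` near `0` is path connected,
  `Literature.Topology.FourManifolds.isPathConnected_quadraticModel` — push `u` to `0`, rescale `v` to a round sphere of
  dimension `≥ 1`); both are transported to the manifold by `Literature.Topology.FourManifolds.localJoin_of_chart`.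
* **Assembly** (`Literature.Topology.FourManifolds.IsMorseAdapted.isPreconnected_boundary_and_nonempty`): for a Morse function
  adapted to the boundary of a compact connected manifold all of whose critical points have
  coindex `≥ 2`, `∂M = f⁻¹(1)` is preconnected, and nonempty because the maximum of `f`
  cannot be attained at an interior point (such a point adheres to `{f > f x}` by (i)). For a
  handlebody the index bound `λ ≤ 1 = 3 - 2` comes from the handle count, and connectedness
  passes to `b.carrier` through the embedding `b.incl`
  (`Literature.Topology.FourManifolds.IsHandlebody.connectedSpace_boundary_holds`).

refactor: the material up to `Literature.Topology.FourManifolds.IsMorseAdapted.isPreconnected_boundary_and_nonempty` does not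
depend on `LickorishWallace.lean` and could live in its own file (it is what shows, e.g., that
the `1`-handlebodies `♮ᵏ(S¹ × B³)` of a trisection have connected boundary).

## References

* A. Juhász, *Differential and Low-Dimensional Topology*, LMS Student Texts 104, CUP (2023):
  §1.5 (pp. 26–27), §1.6 (p. 31), §3.5 (p. 96), Def. 3.27. [Juhasz2023]
* J. Milnor, *Morse theory*, Ann. of Math. Studies 51 (1963), Lemma 2.2, Thms. 3.1–3.2,
  Remark 3.3. [Milnor1963]
* J. Milnor, *Lectures on the h-cobordism theorem*, Princeton (1965), Def. 3.1, Thm. 3.12.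
  [MilnorHCobordism1965]
* J. Schultens, *Introduction to 3-Manifolds*, GSM 151 (2014), Def. 6.1.5. [Schultens2014]
-/

open scoped Manifold ContDiff Topology
open Set Function Filter Metric

noncomputable section

namespace Literature.Topology.FourManifolds

universe u

/-! ### Topology: nested continua -/

section NestedContinua

variable {X : Type*} [TopologicalSpace X]

/-- The intersection of a decreasing sequence of compact connected sets in a Hausdorff space is
preconnected (it is in fact a continuum when the sets are nonempty). [folklore] -/
theorem isPreconnected_iInter_of_antitone [T2Space X] {D : ℕ → Set X} (hD : Antitone D)
    (hc : ∀ n, IsCompact (D n)) (hconn : ∀ n, IsPreconnected (D n)) :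
    IsPreconnected (⋂ n, D n) := by
  have hcl : IsClosed (⋂ n, D n) := isClosed_iInter fun n => (hc n).isClosed
  rw [isPreconnected_iff_subset_of_fully_disjoint_closed hcl]
  intro u v hu hv hsub huv
  -- separate the compact sets `u ∩ D 0`, `v ∩ D 0` by disjoint open sets
  obtain ⟨U, V, hU, hV, huU, hvV, hUV⟩ := SeparatedNhds.of_isCompact_isCompact
    ((hc 0).inter_left hu) ((hc 0).inter_left hv) (huv.mono inter_subset_left inter_subset_left)
  -- some `D N` lies in `U ∪ V`
  have hN : ∃ N, D N ⊆ U ∪ V := by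
    by_contra h
    push Not at h
    have hne : ∀ n, (D n \ (U ∪ V)).Nonempty := fun n => by
      obtain ⟨x, hx, hx'⟩ := not_subset.1 (h n)
      exact ⟨x, hx, hx'⟩
    have key := IsCompact.nonempty_iInter_of_sequence_nonempty_isCompact_isClosed
      (fun n => D n \ (U ∪ V)) (fun n => Set.sdiff_subset_sdiff_left (hD (Nat.le_succ n))) hne
      ((hc 0).diff (hU.union hV)) (fun n => (hc n).isClosed.sdiff (hU.union hV))
    obtain ⟨x, hx⟩ := key
    rw [mem_iInter] at hx
    have hx0 : x ∈ ⋂ n, D n := mem_iInter.2 fun n => (hx n).1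
    have hxuv : x ∈ u ∪ v := hsub hx0
    have hxD0 : x ∈ D 0 := (hx 0).1
    rcases hxuv with hxu | hxv
    · exact (hx 0).2 (Or.inl (huU ⟨hxu, hxD0⟩))
    · exact (hx 0).2 (Or.inr (hvV ⟨hxv, hxD0⟩))
  obtain ⟨N, hN⟩ := hN
  have hsubN : (⋂ n, D n) ⊆ D N := iInter_subset _ N
  have hsub0 : (⋂ n, D n) ⊆ D 0 := iInter_subset _ 0
  rcases (hconn N).subset_or_subset hU hV hUV hN with h | h
  · left
    intro x hx
    rcases hsub hx with hxu | hxv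
    · exact hxu
    · exact absurd (Set.disjoint_left.1 hUV (h (hsubN hx))) (not_not.2 (hvV ⟨hxv, hsub0 hx⟩))
  · right
    intro x hx
    rcases hsub hx with hxu | hxv
    · exact absurd (h (hsubN hx)) (Set.disjoint_left.1 hUV (huU ⟨hxu, hsub0 hx⟩))
    · exact hxv

end NestedContinua

/-! ### Topology: the top level of a function without merging passes -/

section TopLevel

variable {X : Type*} [TopologicalSpace X] [T2Space X] [CompactSpace X] [PreconnectedSpace X]
  [LocallyPathConnectedSpace X]

/-- **The top level of a function without "merging passes" is connected.** Let `X` be a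
compact connected Hausdorff, locally path connected space and `f : X → ℝ` continuous with
`f ≤ a`. Assume that every point `x` below the top level (`f x < a`) adheres to the strict
superlevel set `{f > f x}` and has arbitrarily small neighbourhoods `U` any two points of which
lying strictly above the level of `x` can be joined by a path strictly above that level. Then
the top level `f ⁻¹' {a}` is preconnected. (For a Morse function adapted to the boundary of a
compact manifold the two local conditions hold at regular points and at critical points of
coindex `≥ 2`, `Literature.Topology.FourManifolds.localJoin_of_not_isMCriticalPt`, `Literature.Topology.FourManifolds.localJoin_of_isMCriticalPt`; they
fail exactly at the critical points where two sheets of a superlevel set merge, i.e. where a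
handle of index `≤ 1` of `-f` is attached, cf. Milnor, *Morse theory* (1963), Thms. 3.1–3.2 and
Remark 3.3.) Proof: see the module docstring (supremum of the levels at which the component of
a point of one side still reaches the other side; nested continua; a chain argument at the
critical level). [folklore] -/
theorem isPreconnected_preimage_top_of_joinedIn {f : X → ℝ} (hf : Continuous f) {a : ℝ}
    (ha : ∀ x, f x ≤ a) (hcl : ∀ x, f x < a → x ∈ closure {y | f x < f y})
    (hloc : ∀ x, f x < a → ∀ N ∈ 𝓝 x, ∃ U ∈ 𝓝 x, U ⊆ N ∧
      ∀ p ∈ U, ∀ q ∈ U, f x < f p → f x < f q → JoinedIn {y | f x < f y} p q) :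
    IsPreconnected (f ⁻¹' {a}) := by
  set S : Set X := f ⁻¹' {a} with hS
  have hSc : IsClosed S := isClosed_singleton.preimage hf
  rw [isPreconnected_iff_subset_of_fully_disjoint_closed hSc]
  intro u v hu hv hSuv huv
  by_contra hcon
  rcases not_or.1 hcon with ⟨hSu, hSv⟩
  obtain ⟨b, hbS, hbu⟩ := not_subset.1 hSu
  obtain ⟨a₀, ha₀S, ha₀v⟩ := not_subset.1 hSv
  have ha₀u : a₀ ∈ u := (hSuv ha₀S).resolve_right ha₀v
  have hbv : b ∈ v := (hSuv hbS).resolve_left hbu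
  have hfa₀ : f a₀ = a := ha₀S
  have hfb : f b = a := hbS
  -- disjoint open neighbourhoods of the closed sets `u`, `v`
  haveI : NormalSpace X := NormalSpace.of_compactSpace_r1Space
  obtain ⟨U', V', hU', hV', huU', hvV', hUV'⟩ := normal_separation hu hv huv
  -- superlevel sets and the component of `a₀` in them
  set K : ℝ → Set X := fun c => {x | c ≤ f x} with hK
  have hKc : ∀ c, IsClosed (K c) := fun c => isClosed_le continuous_const hf
  have hKmono : ∀ {c c'}, c ≤ c' → K c' ⊆ K c := fun h x hx => le_trans h hx
  set C : ℝ → Set X := fun c => connectedComponentIn (K c) a₀ with hC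
  have hCmono : ∀ {c c'}, c ≤ c' → C c' ⊆ C c :=
    fun h => connectedComponentIn_mono a₀ (hKmono h)
  have ha₀C : ∀ {c}, c ≤ a → a₀ ∈ C c := fun {c} h =>
    mem_connectedComponentIn (show c ≤ f a₀ by rw [hfa₀]; exact h)
  have hCpre : ∀ c, IsPreconnected (C c) := fun c => isPreconnected_connectedComponentIn
  have hCsub : ∀ c, C c ⊆ K c := fun c => connectedComponentIn_subset _ _
  have hCmax : ∀ {c} {Z : Set X}, IsPreconnected Z → a₀ ∈ Z → Z ⊆ K c → Z ⊆ C c :=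
    fun hZ hZa hZK => hZ.subset_connectedComponentIn hZa hZK
  -- Step 1: a level `c₀ < a` above which everything lies in `U' ∪ V'`
  obtain ⟨c₀, hc₀a, hc₀⟩ : ∃ c₀ < a, K c₀ ⊆ U' ∪ V' := by
    set Z : Set X := (U' ∪ V')ᶜ with hZ
    have hZc : IsCompact Z := (hU'.union hV').isClosed_compl.isCompact
    rcases Z.eq_empty_or_nonempty with hZe | hZne
    · refine ⟨a - 1, by linarith, fun x _ => ?_⟩
      by_contra hx
      have hxZ : x ∈ Z := hx
      rw [hZe] at hxZ
      exact hxZ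
    · obtain ⟨z, hzZ, hz⟩ := hZc.exists_isMaxOn hZne hf.continuousOn
      have hzS : z ∉ S := by
        intro h
        rcases hSuv h with hzu | hzv
        · exact hzZ (Or.inl (huU' hzu))
        · exact hzZ (Or.inr (hvV' hzv))
      have hfz : f z < a := lt_of_le_of_ne (ha z) hzS
      refine ⟨(f z + a) / 2, by linarith, fun x hx => ?_⟩
      by_contra hxUV
      have hxZ : x ∈ Z := hxUV
      have h1 : f x ≤ f z := hz hxZ
      have h2 : (f z + a) / 2 ≤ f x := hx
      linarith
  -- the set of levels at which the component of `a₀` still reaches `v ∩ S`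
  set T : Set ℝ := {c | (C c ∩ (v ∩ S)).Nonempty} with hT
  have hTlower : ∀ {c c'}, c ≤ c' → c' ∈ T → c ∈ T :=
    fun h ⟨x, hx, hx'⟩ => ⟨x, hCmono h hx, hx'⟩
  -- a lower bound `m₀` of `f`; `m₀ ∈ T`
  obtain ⟨m₀, hm₀⟩ : ∃ m₀, ∀ x, m₀ ≤ f x := by
    obtain ⟨x₀, -, hx₀⟩ :=
      isCompact_univ.exists_isMinOn ⟨a₀, mem_univ a₀⟩ hf.continuousOn
    exact ⟨f x₀, fun x => hx₀ (mem_univ x)⟩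
  have hm₀a : m₀ ≤ a := (hm₀ a₀).trans hfa₀.le
  have hm₀T : m₀ ∈ T := by
    have hKm₀ : K m₀ = univ := eq_univ_of_forall fun x => hm₀ x
    have hCm₀ : C m₀ = univ := by
      show connectedComponentIn (K m₀) a₀ = univ
      rw [hKm₀, connectedComponentIn_univ, PreconnectedSpace.connectedComponent_eq_univ]
    exact ⟨b, by rw [hCm₀]; exact mem_univ b, hbv, hbS⟩
  -- every level in `T` is `< c₀` (above `c₀` the component of `a₀` stays inside `U'`)
  have hTlt : ∀ c ∈ T, c < c₀ := by
    intro c hc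
    by_contra hcc
    rw [not_lt] at hcc
    obtain ⟨x, hxC, hxv, hxS⟩ := hc
    have hca : c ≤ a := by
      have := hCsub c hxC
      exact this.trans (ha x)
    have hsub : C c ⊆ U' :=
      (hCpre c).subset_left_of_subset_union hU' hV' hUV'
        (((hCsub c).trans (hKmono hcc)).trans hc₀) ⟨a₀, ha₀C hca, huU' ha₀u⟩
    exact Set.disjoint_left.1 hUV' (hsub hxC) (hvV' hxv)
  have hTbdd : BddAbove T := ⟨c₀, fun c hc => (hTlt c hc).le⟩
  have hTne : T.Nonempty := ⟨m₀, hm₀T⟩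
  -- the critical level
  set cs : ℝ := sSup T with hcs
  have hcsc₀ : cs ≤ c₀ := csSup_le hTne fun c hc => (hTlt c hc).le
  have hcsa : cs < a := hcsc₀.trans_lt hc₀a
  have hm₀cs : m₀ ≤ cs := le_csSup hTbdd hm₀T
  have hTlt' : ∀ c < cs, c ∈ T := fun c hc => by
    obtain ⟨t, htT, hct⟩ := exists_lt_of_lt_csSup hTne hc
    exact hTlower hct.le htT
  -- Step 2: `cs ∈ T` (nested intersection of continua)
  have hcsT : cs ∈ T := by
    set D : ℕ → Set X := fun n => C (cs - 1 / ((n : ℝ) + 1)) with hD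
    have hpos : ∀ n : ℕ, (0 : ℝ) < 1 / ((n : ℝ) + 1) := fun n => Nat.one_div_pos_of_nat
    have hDanti : Antitone D := by
      intro m n hmn
      apply hCmono
      have h1 : (1 : ℝ) / ((n : ℝ) + 1) ≤ 1 / ((m : ℝ) + 1) :=
        one_div_le_one_div_of_le (by positivity) (by exact_mod_cast Nat.succ_le_succ hmn)
      linarith
    have hDc : ∀ n, IsCompact (D n) := fun n => by
      -- a component of the closed set `K _` is closed (cf.
      -- `Literature.Probability.RandomPlanarGeometry.isClosed_connectedComponentIn_of_isClosed`, `HullDecomposition.lean`)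
      refine (isClosed_of_closure_subset ?_).isCompact
      exact isPreconnected_connectedComponentIn.closure.subset_connectedComponentIn
        (subset_closure (ha₀C (by linarith [hpos n])))
        (closure_minimal (connectedComponentIn_subset _ _) (hKc _))
    have hDT : ∀ n, (D n ∩ (v ∩ S)).Nonempty := fun n => hTlt' _ (by linarith [hpos n])
    have hL : IsPreconnected (⋂ n, D n) :=
      isPreconnected_iInter_of_antitone hDanti hDc fun n => hCpre _
    have ha₀L : a₀ ∈ ⋂ n, D n := mem_iInter.2 fun n => ha₀C (by linarith [hpos n])
    have hLK : (⋂ n, D n) ⊆ K cs := by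
      intro x hx
      rw [mem_iInter] at hx
      have hxn : ∀ n : ℕ, cs - 1 / ((n : ℝ) + 1) ≤ f x := fun n => hCsub _ (hx n)
      have hlim : Tendsto (fun n : ℕ => cs - 1 / ((n : ℝ) + 1)) atTop (𝓝 (cs - 0)) :=
        tendsto_const_nhds.sub tendsto_one_div_add_atTop_nhds_zero_nat
      rw [sub_zero] at hlim
      exact le_of_tendsto' hlim hxn
    have hLC : (⋂ n, D n) ⊆ C cs := hCmax hL ha₀L hLK
    have hne : (⋂ n, D n ∩ (v ∩ S)).Nonempty := by
      refine IsCompact.nonempty_iInter_of_sequence_nonempty_isCompact_isClosed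
        (fun n => D n ∩ (v ∩ S)) (fun n => ?_) hDT ((hDc 0).inter_right (hv.inter hSc))
        (fun n => (hDc n).isClosed.inter (hv.inter hSc))
      exact inter_subset_inter_left _ (hDanti (Nat.le_succ n))
    obtain ⟨x, hx⟩ := hne
    rw [← iInter_inter] at hx
    exact ⟨x, hLC hx.1, hx.2⟩
  -- Step 3: at the critical level, join `a₀` to a point `b' ∈ v ∩ S` strictly above `cs`
  obtain ⟨b', hb'C, hb'v, hb'S⟩ := hcsT
  have hfb' : f b' = a := hb'S
  set P : Set X := {y | cs < f y} with hP
  have hPo : IsOpen P := isOpen_lt continuous_const hf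
  -- local joining neighbourhoods along `C cs`
  have hU : ∀ x ∈ C cs, ∃ U ∈ 𝓝 x,
      ∀ p ∈ U, ∀ q ∈ U, cs < f p → cs < f q → JoinedIn P p q := by
    intro x hx
    have hxK : cs ≤ f x := hCsub _ hx
    rcases hxK.lt_or_eq with hlt | heq
    · -- `x` strictly above the level: a path connected neighbourhood inside `P`
      obtain ⟨U, ⟨hUx, hUpc⟩, hUP⟩ :=
        (path_connected_basis x).mem_iff.1 (hPo.mem_nhds (show x ∈ P from hlt))
      exact ⟨U, hUx, fun p hp q hq _ _ => (hUpc.joinedIn p hp q hq).mono hUP⟩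
    · -- `x` on the level: the hypothesis `hloc`
      obtain ⟨U, hUx, -, hUj⟩ := hloc x (heq ▸ hcsa) univ univ_mem
      refine ⟨U, hUx, fun p hp q hq hfp hfq => ?_⟩
      have := hUj p hp q hq (heq ▸ hfp) (heq ▸ hfq)
      rwa [← heq] at this
  choose! U hUn hUj using hU
  have hclP : ∀ x ∈ C cs, x ∈ closure P := by
    intro x hx
    have hxK : cs ≤ f x := hCsub _ hx
    rcases hxK.lt_or_eq with hlt | heq
    · exact subset_closure hlt
    · have := hcl x (heq ▸ hcsa)
      rwa [← heq] at this
  -- the relation "points above the level near `x` and near `y` are joined in `P`"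
  have key : ∀ p ∈ U a₀, ∀ q ∈ U b', cs < f p → cs < f q → JoinedIn P p q := by
    refine (hCpre cs).induction₂'
      (fun x y => ∀ p ∈ U x, ∀ q ∈ U y, cs < f p → cs < f q → JoinedIn P p q)
      (fun x hx => ?_) (fun x y z hx hy hz hxy hyz => ?_) (ha₀C hcsa.le) hb'C
    · -- local constancy near `x ∈ C cs`
      have hmem : C cs ∩ interior (U x) ∈ 𝓝[C cs] x :=
        inter_mem_nhdsWithin _ (interior_mem_nhds.2 (hUn x hx))
      filter_upwards [hmem] with y hy
      obtain ⟨hyC, hyU⟩ := hy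
      have hW : interior (U x) ∩ U y ∈ 𝓝 y :=
        inter_mem (isOpen_interior.mem_nhds hyU) (hUn y hyC)
      obtain ⟨r, hrW, hrP⟩ := mem_closure_iff_nhds.1 (hclP y hyC) _ hW
      have hrx : r ∈ U x := interior_subset hrW.1
      constructor
      · intro p hp q hq hfp hfq
        exact (hUj x hx p hp r hrx hfp hrP).trans (hUj y hyC r hrW.2 q hq hrP hfq)
      · intro p hp q hq hfp hfq
        exact (hUj y hyC p hp r hrW.2 hfp hrP).trans (hUj x hx r hrx q hq hrP hfq)
    · -- transitivity
      intro p hp q hq hfp hfq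
      obtain ⟨r, hrU, hrP⟩ := mem_closure_iff_nhds.1 (hclP y hy) _ (hUn y hy)
      exact (hxy p hp r hrU hfp hrP).trans (hyz r hrU q hq hrP hfq)
  have hjoin : JoinedIn P a₀ b' :=
    key a₀ (mem_of_mem_nhds (hUn a₀ (ha₀C hcsa.le))) b' (mem_of_mem_nhds (hUn b' hb'C))
      (by rw [hfa₀]; exact hcsa) (by rw [hfb']; exact hcsa)
  -- the path is compact, so it stays above some level `c > cs`, and `c ∈ T`: contradiction
  set γ := hjoin.somePath with hγ
  have hZc : IsCompact (range γ) := isCompact_range γ.continuous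
  have hZP : range γ ⊆ P := by
    rintro _ ⟨t, rfl⟩
    exact hjoin.somePath_mem t
  obtain ⟨z₀, ⟨t₀, rfl⟩, hz₀⟩ :=
    hZc.exists_isMinOn (range_nonempty γ) hf.continuousOn
  have hcz : cs < f (γ t₀) := hZP ⟨t₀, rfl⟩
  have hZK : range γ ⊆ K (f (γ t₀)) := fun z hz => hz₀ hz
  have hZC : range γ ⊆ C (f (γ t₀)) :=
    hCmax (isPreconnected_range γ.continuous) ⟨0, γ.source⟩ hZK
  have hT' : f (γ t₀) ∈ T := ⟨b', hZC ⟨1, γ.target⟩, hb'v, hb'S⟩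
  exact absurd (le_csSup hTbdd hT') (not_le.2 hcz)

end TopLevel

/-! ### The quadratic model `-Σ_{i<k} zᵢ² + Σ_{i≥k} zᵢ²` on `ℝᵐ` -/

section QuadraticModel

variable {m : ℕ}

/-- Splitting `‖z‖²` on `ℝᵐ` into the coordinates below `k` and the coordinates from `k`
on: `Σ_{i<k} zᵢ² + Σ_{i≥k} zᵢ² = ‖z‖²`. [folklore] -/
theorem sum_sq_lt_add_sum_sq_le (k : ℕ) (z : EuclideanSpace ℝ (Fin m)) :
    (∑ i ∈ Finset.univ.filter (fun i : Fin m => i.val < k), z i ^ 2) +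
      ∑ i ∈ Finset.univ.filter (fun i : Fin m => k ≤ i.val), z i ^ 2 = ‖z‖ ^ 2 := by
  rw [EuclideanSpace.norm_sq_eq]
  have h := Finset.sum_filter_add_sum_filter_not Finset.univ (fun i : Fin m => i.val < k)
    (fun i => z i ^ 2)
  simp only [not_lt] at h
  rw [h]
  refine Finset.sum_congr rfl fun i _ => ?_
  rw [Real.norm_eq_abs, sq_abs]

/-- For `k + 2 ≤ m` the coordinate space `ℝ^{{i | k ≤ i}}` has dimension `> 1`. [folklore] -/
theorem one_lt_rank_euclideanSpace_subtype_le {k : ℕ} (hk : k + 2 ≤ m) :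
    1 < Module.rank ℝ (EuclideanSpace ℝ {i : Fin m // k ≤ i.val}) := by
  rw [← Module.finrank_eq_rank, finrank_euclideanSpace]
  have h2 : 1 < Fintype.card {i : Fin m // k ≤ i.val} := by
    rw [Fintype.one_lt_card_iff_nontrivial]
    refine
      ⟨⟨⟨⟨k, by omega⟩, le_rfl⟩, ⟨⟨k + 1, by omega⟩, Nat.le_succ k⟩, ?_⟩⟩
    simp [Subtype.ext_iff, Fin.ext_iff]
  exact_mod_cast h2

/-- **The strict superlevel set of the quadratic model is path connected near the origin.**
For `k + 2 ≤ m`, `0 < a` and `0 < r`, the set of `z ∈ ℝᵐ` with `Σ_{i<k} zᵢ² < a²`,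
`Σ_{i≥k} zᵢ² < r²` and `Σ_{i<k} zᵢ² < Σ_{i≥k} zᵢ²` is path connected: push `z` to
the subspace `{z_{<k} = 0}` along a segment, rescale there to the sphere
`Σ_{i≥k} zᵢ² = (r/2)²`,
which is a round sphere of dimension `m - k - 1 ≥ 1`, hence path connected. (This is the
statement that the ascending region `{f > f(p)}` near a nondegenerate critical point `p` of
coindex `≥ 2` is connected; Milnor, *Morse theory* (1963), proof of Thm. 3.2 and Remark 3.3.)
[folklore] -/
theorem isPathConnected_quadraticModel {k : ℕ} (hk : k + 2 ≤ m) {a r : ℝ} (ha : 0 < a)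
    (hr : 0 < r) :
    IsPathConnected {z : EuclideanSpace ℝ (Fin m) |
      (∑ i ∈ Finset.univ.filter (fun i : Fin m => i.val < k), z i ^ 2) < a ^ 2 ∧
      (∑ i ∈ Finset.univ.filter (fun i : Fin m => k ≤ i.val), z i ^ 2) < r ^ 2 ∧
      (∑ i ∈ Finset.univ.filter (fun i : Fin m => i.val < k), z i ^ 2) <
        ∑ i ∈ Finset.univ.filter (fun i : Fin m => k ≤ i.val), z i ^ 2} := by
  -- the two blocks of coordinates
  set A : EuclideanSpace ℝ (Fin m) → ℝ :=
    fun z => ∑ i ∈ Finset.univ.filter (fun i : Fin m => i.val < k), z i ^ 2 with hA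
  set B : EuclideanSpace ℝ (Fin m) → ℝ :=
    fun z => ∑ i ∈ Finset.univ.filter (fun i : Fin m => k ≤ i.val), z i ^ 2 with hB
  set Ω : Set (EuclideanSpace ℝ (Fin m)) := {z | A z < a ^ 2 ∧ B z < r ^ 2 ∧ A z < B z}
    with hΩ
  show IsPathConnected Ω
  have hA0 : ∀ z, 0 ≤ A z := fun z => Finset.sum_nonneg fun _ _ => sq_nonneg _
  have hAsmul : ∀ (c : ℝ) z, A (c • z) = c ^ 2 * A z := fun c z => by
    simp only [hA, PiLp.smul_apply, smul_eq_mul, mul_pow, Finset.mul_sum]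
  have hBsmul : ∀ (c : ℝ) z, B (c • z) = c ^ 2 * B z := fun c z => by
    simp only [hB, PiLp.smul_apply, smul_eq_mul, mul_pow, Finset.mul_sum]
  -- killing the first `k` coordinates
  set kill : EuclideanSpace ℝ (Fin m) → EuclideanSpace ℝ (Fin m) :=
    fun z => WithLp.toLp 2 fun i => if k ≤ i.val then z i else 0 with hkill
  have hkill_apply : ∀ z (i : Fin m), kill z i = if k ≤ i.val then z i else 0 := fun z i => rfl
  have hkill_low : ∀ z (i : Fin m), i.val < k → kill z i = 0 := fun z i hi => by
    rw [hkill_apply, if_neg (not_le.2 hi)]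
  have hAkill : ∀ z, A (kill z) = 0 := fun z => by
    refine Finset.sum_eq_zero fun i hi => ?_
    rw [Finset.mem_filter] at hi
    rw [hkill_low z i hi.2]; ring
  have hBkill : ∀ z, B (kill z) = B z := fun z => by
    refine Finset.sum_congr rfl fun i hi => ?_
    rw [Finset.mem_filter] at hi
    rw [hkill_apply, if_pos hi.2]
  have hAline : ∀ (a' b' : ℝ) z, A (a' • z + b' • kill z) = a' ^ 2 * A z :=
      fun a' b' z => by
    simp only [hA, Finset.mul_sum]
    refine Finset.sum_congr rfl fun i hi => ?_
    rw [Finset.mem_filter] at hi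
    simp only [PiLp.add_apply, PiLp.smul_apply, smul_eq_mul, hkill_low z i hi.2, mul_zero,
      add_zero, mul_pow]
  have hBline : ∀ (a' b' : ℝ), a' + b' = 1 → ∀ z, B (a' • z + b' • kill z) = B z :=
    fun a' b' hab z => by
    simp only [hB]
    refine Finset.sum_congr rfl fun i hi => ?_
    rw [Finset.mem_filter] at hi
    simp only [PiLp.add_apply, PiLp.smul_apply, smul_eq_mul, hkill_apply, if_pos hi.2]
    rw [← add_mul, hab, one_mul]
  -- padding the last coordinates by zeros
  set pad : EuclideanSpace ℝ {i : Fin m // k ≤ i.val} → EuclideanSpace ℝ (Fin m) :=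
    fun w => WithLp.toLp 2 fun i => if h : k ≤ i.val then w ⟨i, h⟩ else 0 with hpad
  have hpad_apply : ∀ w (i : Fin m), pad w i = if h : k ≤ i.val then w ⟨i, h⟩ else 0 :=
    fun w i => rfl
  have hApad : ∀ w, A (pad w) = 0 := fun w => by
    refine Finset.sum_eq_zero fun i hi => ?_
    rw [Finset.mem_filter] at hi
    rw [hpad_apply, dif_neg (not_le.2 hi.2)]; ring
  have hBpad : ∀ w, B (pad w) = ‖w‖ ^ 2 := fun w => by
    rw [EuclideanSpace.norm_sq_eq, hB]
    simp only
    rw [Finset.sum_subtype (Finset.univ.filter (fun i : Fin m => k ≤ i.val))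
      (p := fun i => k ≤ i.val) (fun i => by simp)]
    refine Finset.sum_congr rfl fun j _ => ?_
    rw [hpad_apply, dif_pos j.2, Real.norm_eq_abs, sq_abs]
  have hpadc : Continuous pad := by
    refine (PiLp.continuous_toLp 2 _).comp (continuous_pi fun i => ?_)
    by_cases h : k ≤ i.val
    · simp only [h, dif_pos]
      exact PiLp.continuous_apply 2 _ _
    · simp only [h, dif_neg, not_false_eq_true]
      exact continuous_const
  have hexpad : ∀ z : EuclideanSpace ℝ (Fin m), (∀ i : Fin m, i.val < k → z i = 0) →
      ∃ w, pad w = z ∧ ‖w‖ ^ 2 = B z := fun z hz => by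
    have key : pad (WithLp.toLp 2 fun j : {i : Fin m // k ≤ i.val} => z j.val) = z := by
      ext i
      rw [hpad_apply]
      by_cases h : k ≤ i.val
      · rw [dif_pos h]
      · rw [dif_neg h, hz i (not_le.1 h)]
    exact ⟨_, key, by rw [← hBpad, key]⟩
  -- the sphere of radius `ρ = r / 2` in the last coordinates
  set ρ : ℝ := r / 2 with hρ
  have hρ0 : 0 < ρ := by positivity
  have hρr : ρ < r := by rw [hρ]; linarith
  set Sρ : Set (EuclideanSpace ℝ (Fin m)) :=
    pad '' sphere (0 : EuclideanSpace ℝ {i : Fin m // k ≤ i.val}) ρ with hSρ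
  have hSρpc : IsPathConnected Sρ :=
    (isPathConnected_sphere (one_lt_rank_euclideanSpace_subtype_le hk) 0 hρ0.le).image hpadc
  have hSρΩ : Sρ ⊆ Ω := by
    rintro _ ⟨w, hw, rfl⟩
    rw [mem_sphere_zero_iff_norm] at hw
    refine ⟨?_, ?_, ?_⟩
    · rw [hApad]; positivity
    · rw [hBpad, hw]; exact pow_lt_pow_left₀ hρr hρ0.le two_ne_zero
    · rw [hApad, hBpad, hw]; positivity
  -- Step A: from `z ∈ Ω` to `kill z` along a segment
  have hstepA : ∀ z ∈ Ω, JoinedIn Ω z (kill z) := by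
    rintro z ⟨h1, h2, h3⟩
    refine JoinedIn.of_segment_subset ?_
    rintro _ ⟨a', b', ha', hb', hab, rfl⟩
    have hsq : a' ^ 2 * A z ≤ A z := by
      have : a' ^ 2 ≤ 1 := by nlinarith
      nlinarith [hA0 z]
    refine ⟨?_, ?_, ?_⟩
    · rw [hAline]; exact hsq.trans_lt h1
    · rw [hBline a' b' hab]; exact h2
    · rw [hAline, hBline a' b' hab]; exact hsq.trans_lt h3
  -- Step B: from `kill z` to the sphere `Sρ` along a radial segment
  have hstepB : ∀ z ∈ Ω, ∃ s ∈ Sρ, JoinedIn Ω (kill z) s := by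
    rintro z ⟨h1, h2, h3⟩
    set p : EuclideanSpace ℝ (Fin m) := kill z with hp
    have hBp : B p = B z := hBkill z
    have hB0 : 0 < B z := (hA0 z).trans_lt h3
    have hsB : 0 < Real.sqrt (B z) := Real.sqrt_pos.2 hB0
    have hsBr : Real.sqrt (B z) < r := by
      calc Real.sqrt (B z) < Real.sqrt (r ^ 2) := Real.sqrt_lt_sqrt hB0.le h2
        _ = r := Real.sqrt_sq hr.le
    set c : ℝ := ρ / Real.sqrt (B z) with hc
    have hc0 : 0 < c := by positivity
    -- the endpoint `c • p` lies on `Sρ`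
    have hcp : c • p ∈ Sρ := by
      obtain ⟨w, hw, hw'⟩ := hexpad (c • p) fun i hi => by
        rw [PiLp.smul_apply, hkill_low z i hi, smul_zero]
      refine ⟨w, ?_, hw⟩
      rw [mem_sphere_zero_iff_norm]
      have hw2 : ‖w‖ ^ 2 = ρ ^ 2 := by
        rw [hw', hBsmul, hBp, hc, div_pow, Real.sq_sqrt hB0.le, div_mul_cancel₀ _ hB0.ne']
      nlinarith [norm_nonneg w, sq_nonneg (‖w‖ - ρ), sq_nonneg (‖w‖ + ρ)]
    refine ⟨c • p, hcp, JoinedIn.of_segment_subset ?_⟩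
    rintro _ ⟨a', b', ha', hb', hab, rfl⟩
    have hpt : a' • p + b' • (c • p) = (a' + b' * c) • p := by rw [smul_smul, ← add_smul]
    rw [hpt]
    set s : ℝ := a' + b' * c with hs
    have hsr : s * Real.sqrt (B z) < r := by
      have hbc : b' * c * Real.sqrt (B z) = b' * ρ := by
        rw [hc, mul_assoc, div_mul_cancel₀ _ hsB.ne']
      rw [hs, add_mul, hbc]
      rcases ha'.lt_or_eq with ha'pos | ha'0
      · calc a' * Real.sqrt (B z) + b' * ρ < a' * r + b' * r := by
              have := mul_lt_mul_of_pos_left hsBr ha'pos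
              nlinarith
          _ = r := by rw [← add_mul, hab, one_mul]
      · have hb1 : b' = 1 := by linarith
        rw [← ha'0, hb1]; linarith
    have hs0 : 0 < s := by
      rcases ha'.lt_or_eq with ha'pos | ha'0
      · have : 0 ≤ b' * c := mul_nonneg hb' hc0.le
        linarith
      · have hb1 : b' = 1 := by linarith
        rw [hs, ← ha'0, hb1]; linarith
    have hsB2 : s ^ 2 * B z < r ^ 2 := by
      have h0 : 0 ≤ s * Real.sqrt (B z) := by positivity
      calc s ^ 2 * B z = (s * Real.sqrt (B z)) ^ 2 := by rw [mul_pow, Real.sq_sqrt hB0.le]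
        _ < r ^ 2 := pow_lt_pow_left₀ hsr h0 two_ne_zero
    refine ⟨?_, ?_, ?_⟩
    · rw [hAsmul, hp, hAkill, mul_zero]; positivity
    · rw [hBsmul, hBp]; exact hsB2
    · rw [hAsmul, hBsmul, hp, hAkill, mul_zero, hBkill]; positivity
  -- conclusion
  obtain ⟨s₀, hs₀⟩ : Sρ.Nonempty := hSρpc.nonempty
  refine ⟨s₀, hSρΩ hs₀, fun z hz => ?_⟩
  obtain ⟨s, hs, hps⟩ := hstepB z hz
  have h1 : JoinedIn Ω s₀ s := (hSρpc.joinedIn s₀ hs₀ s hs).mono hSρΩ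
  exact h1.trans (hps.symm.trans (hstepA z hz).symm)

/-- The origin adheres to the strict superlevel set of the quadratic model (approach it along
the `k`-th coordinate axis, a positive direction, which exists as `k < m`). [folklore] -/
theorem zero_mem_closure_quadraticModel {k : ℕ} (hk : k + 2 ≤ m) {a r : ℝ} (ha : 0 < a)
    (hr : 0 < r) :
    (0 : EuclideanSpace ℝ (Fin m)) ∈ closure {z : EuclideanSpace ℝ (Fin m) |
      (∑ i ∈ Finset.univ.filter (fun i : Fin m => i.val < k), z i ^ 2) < a ^ 2 ∧
      (∑ i ∈ Finset.univ.filter (fun i : Fin m => k ≤ i.val), z i ^ 2) < r ^ 2 ∧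
      (∑ i ∈ Finset.univ.filter (fun i : Fin m => i.val < k), z i ^ 2) <
        ∑ i ∈ Finset.univ.filter (fun i : Fin m => k ≤ i.val), z i ^ 2} := by
  set j : Fin m := ⟨k, by omega⟩ with hj
  set e : EuclideanSpace ℝ (Fin m) := EuclideanSpace.single j 1 with he
  have hcont : Continuous fun t : ℝ => t • e := continuous_id.smul continuous_const
  have hlim : Tendsto (fun t : ℝ => t • e) (𝓝[>] 0) (𝓝 0) := by
    have := hcont.tendsto 0
    rw [zero_smul] at this
    exact this.mono_left nhdsWithin_le_nhds
  refine mem_closure_of_tendsto hlim ?_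
  filter_upwards [Ioo_mem_nhdsGT hr] with t ht
  have hlow : (∑ i ∈ Finset.univ.filter (fun i : Fin m => i.val < k), (t • e) i ^ 2) = 0 := by
    refine Finset.sum_eq_zero fun i hi => ?_
    rw [Finset.mem_filter] at hi
    have hij : i ≠ j := fun h => by rw [h, hj] at hi; exact lt_irrefl _ hi.2
    simp [he, hij]
  have hhigh :
      (∑ i ∈ Finset.univ.filter (fun i : Fin m => k ≤ i.val), (t • e) i ^ 2) = t ^ 2 := by
    have : ∑ i ∈ Finset.univ.filter (fun i : Fin m => k ≤ i.val), (e i) ^ 2 = 1 := by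
      rw [Finset.sum_eq_single j]
      · simp [he]
      · intro i _ hij
        simp [he, hij]
      · intro h
        exfalso
        exact h (Finset.mem_filter.2 ⟨Finset.mem_univ _, by rw [hj]⟩)
    simp only [PiLp.smul_apply, smul_eq_mul, mul_pow, ← Finset.mul_sum]
    rw [this, mul_one]
  refine ⟨?_, ?_, ?_⟩
  · rw [hlow]; positivity
  · rw [hhigh]; exact pow_lt_pow_left₀ ht.2 ht.1.le two_ne_zero
  · rw [hlow, hhigh]; exact pow_pos ht.1 2

end QuadraticModel

/-! ### Transport of the local picture through a chart -/

section Transport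

variable {m : ℕ} {H : Type*} [TopologicalSpace H]
  {I : ModelWithCorners ℝ (EuclideanSpace ℝ (Fin m)) H} {M : Type*} [TopologicalSpace M]

/-- **Local joining from a chart model.** Let `ψ` be a chart of `M` around `x` with values in
the interior of the model, in which `f` reads `g`: `f q = g (I (ψ q))` on `ψ.source`. If the
model point `y₀ = I (ψ x)` adheres to the strict superlevel set `{g > g y₀}` and has
arbitrarily small open neighbourhoods `O` for which `{y ∈ O | g y₀ < g y}` is path connected,
then `x` adheres to `{f > f x}` and has arbitrarily small neighbourhoods `U` any two points of
which lying in `{f > f x}` are joined by a path in `{f > f x}` (push the model paths forward by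
`ψ⁻¹ ∘ I⁻¹`). [folklore] -/
theorem localJoin_of_chart {f : M → ℝ} {x : M} (ψ : OpenPartialHomeomorph M H)
    (hxψ : x ∈ ψ.source) (hint : ∀ q ∈ ψ.source, I (ψ q) ∈ interior (range I))
    (g : (EuclideanSpace ℝ (Fin m)) → ℝ) (hg : ∀ q ∈ ψ.source, f q = g (I (ψ q)))
    (hmodel : ∀ ε > 0, ∃ O : Set (EuclideanSpace ℝ (Fin m)), IsOpen O ∧ I (ψ x) ∈ O ∧
      O ⊆ ball (I (ψ x)) ε ∧ IsPathConnected {y ∈ O | g (I (ψ x)) < g y} ∧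
      I (ψ x) ∈ closure {y ∈ O | g (I (ψ x)) < g y}) :
    x ∈ closure {y | f x < f y} ∧
    ∀ N ∈ 𝓝 x, ∃ U ∈ 𝓝 x, U ⊆ N ∧
      ∀ p ∈ U, ∀ q ∈ U, f x < f p → f x < f q → JoinedIn {y | f x < f y} p q := by
  set y₀ : EuclideanSpace ℝ (Fin m) := I (ψ x) with hy₀
  set V : Set (EuclideanSpace ℝ (Fin m)) := I.symm ⁻¹' ψ.target ∩ interior (range I) with hV
  have hVo : IsOpen V := (ψ.open_target.preimage I.continuous_symm).inter isOpen_interior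
  set Φ : (EuclideanSpace ℝ (Fin m)) → M := fun y => ψ.symm (I.symm y) with hΦ
  have hΦ1 : ∀ q ∈ ψ.source, Φ (I (ψ q)) = q := fun q hq => by
    simp only [hΦ, I.left_inv, ψ.left_inv hq]
  have hΦ2 : ∀ y ∈ V, Φ y ∈ ψ.source ∧ I (ψ (Φ y)) = y := fun y hy => by
    refine ⟨ψ.map_target hy.1, ?_⟩
    simp only [hΦ]
    rw [ψ.right_inv hy.1, I.right_inv (interior_subset hy.2)]
  have hΦc : ContinuousOn Φ V :=
    ψ.continuousOn_symm.comp I.continuous_symm.continuousOn fun y hy => hy.1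
  have hy₀V : y₀ ∈ V := by
    refine ⟨?_, hint x hxψ⟩
    show I.symm (I (ψ x)) ∈ ψ.target
    rw [I.left_inv]
    exact ψ.map_source hxψ
  have hfΦ : ∀ y ∈ V, f (Φ y) = g y := fun y hy => by rw [hg _ (hΦ2 y hy).1, (hΦ2 y hy).2]
  have hgx : g y₀ = f x := (hg x hxψ).symm
  have hΦx : Φ y₀ = x := hΦ1 x hxψ
  have hΦat : ContinuousAt Φ y₀ := hΦc.continuousAt (hVo.mem_nhds hy₀V)
  -- the image of a model superlevel set lies in the superlevel set of `f`
  have himg : ∀ {O : Set (EuclideanSpace ℝ (Fin m))}, O ⊆ V →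
      Φ '' {y ∈ O | g y₀ < g y} ⊆ {y | f x < f y} := by
    rintro O hO _ ⟨y, ⟨hyO, hy⟩, rfl⟩
    show f x < f (Φ y)
    rw [hfΦ y (hO hyO), ← hgx]
    exact hy
  constructor
  · obtain ⟨ε, hε, hεV⟩ := Metric.isOpen_iff.1 hVo y₀ hy₀V
    obtain ⟨O, -, -, hOε, -, hcl⟩ := hmodel ε hε
    have h1 : Φ y₀ ∈ closure (Φ '' {y ∈ O | g y₀ < g y}) :=
      hΦat.continuousWithinAt.mem_closure_image hcl
    rw [hΦx] at h1
    exact closure_mono (himg (hOε.trans hεV)) h1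
  · intro N hN
    have hN' : Φ ⁻¹' N ∈ 𝓝 y₀ := hΦat (by rw [hΦx]; exact hN)
    obtain ⟨ε, hε, hεsub⟩ := Metric.mem_nhds_iff.1 (inter_mem hN' (hVo.mem_nhds hy₀V))
    obtain ⟨O, hO, hy₀O, hOε, hpc, -⟩ := hmodel ε hε
    have hOV : O ⊆ V := fun y hy => (hεsub (hOε hy)).2
    have hON : ∀ y ∈ O, Φ y ∈ N := fun y hy => (hεsub (hOε hy)).1
    refine ⟨ψ.source ∩ ψ ⁻¹' (I ⁻¹' O), ?_, ?_, ?_⟩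
    · exact (ψ.isOpen_inter_preimage (hO.preimage I.continuous)).mem_nhds ⟨hxψ, hy₀O⟩
    · rintro q ⟨hq, hqO⟩
      have := hON _ hqO
      rwa [hΦ1 q hq] at this
    · rintro p ⟨hp, hpO⟩ q ⟨hq, hqO⟩ hfp hfq
      have hp' : I (ψ p) ∈ {y ∈ O | g y₀ < g y} :=
        ⟨hpO, by rw [hgx, ← hg p hp]; exact hfp⟩
      have hq' : I (ψ q) ∈ {y ∈ O | g y₀ < g y} :=
        ⟨hqO, by rw [hgx, ← hg q hq]; exact hfq⟩
      have hj := (hpc.joinedIn _ hp' _ hq').map_continuousOn (hΦc.mono fun y hy => hOV hy.1)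
      rw [hΦ1 p hp, hΦ1 q hq] at hj
      exact hj.mono (himg hOV)

end Transport

/-! ### The local picture at interior regular points and at critical points of coindex `≥ 2` -/

section LocalMorse

variable {n : ℕ} {H : Type*} [TopologicalSpace H]
  {I : ModelWithCorners ℝ (EuclideanSpace ℝ (Fin (n + 1))) H}
  {M : Type*} [TopologicalSpace M] [ChartedSpace H M] [IsManifold I ∞ M]

/-- **The local picture at an interior regular point.** If `f` is smooth and `x` is an interior
point with `df_x ≠ 0`, then `x` adheres to `{f > f x}` and small neighbourhoods of `x` have
their part above the level of `x` path connected inside `{f > f x}`: in a slice chart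
(`Literature.Topology.FourManifolds.exists_sliceChart`, Hirsch 1976, Ch. 1 §3, Thm. 3.2) `f - f x` is the last coordinate, and
the part of a round ball above a hyperplane through its centre is convex. [folklore] -/
theorem localJoin_of_not_isMCriticalPt [SliceModel I] {f : M → ℝ}
    (hf : ContMDiff I 𝓘(ℝ, ℝ) ∞ f) {x : M} (hx : I.IsInteriorPoint x)
    (hc : ¬ IsMCriticalPt I f x) :
    x ∈ closure {y | f x < f y} ∧
    ∀ N ∈ 𝓝 x, ∃ U ∈ 𝓝 x, U ⊆ N ∧
      ∀ p ∈ U, ∀ q ∈ U, f x < f p → f x < f q → JoinedIn {y | f x < f y} p q := by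
  obtain ⟨ψ, -, hxψ, hlast, hint⟩ := exists_sliceChart hf hx hc
  refine localJoin_of_chart ψ hxψ hint (fun y => f x + y (Fin.last n))
    (fun q hq => by rw [hlast q hq]; ring) fun ε hε => ?_
  set y₀ : EuclideanSpace ℝ (Fin (n + 1)) := I (ψ x) with hy₀
  set e : EuclideanSpace ℝ (Fin (n + 1)) := EuclideanSpace.single (Fin.last n) 1 with he
  have he1 : e (Fin.last n) = 1 := by simp [he]
  have hne : ‖e‖ = 1 := by simp [he]
  set Ω : Set (EuclideanSpace ℝ (Fin (n + 1))) :=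
    {y ∈ ball y₀ ε | f x + y₀ (Fin.last n) < f x + y (Fin.last n)} with hΩ
  -- the curve `t ↦ y₀ + t e` enters `Ω` for small `t > 0`
  have hcurve : ∀ t ∈ Ioo (0 : ℝ) ε, y₀ + t • e ∈ Ω := by
    rintro t ⟨ht0, htε⟩
    refine ⟨?_, ?_⟩
    · rw [mem_ball, dist_eq_norm, add_sub_cancel_left, norm_smul, hne, mul_one,
        Real.norm_of_nonneg ht0.le]
      exact htε
    · simp only [PiLp.add_apply, PiLp.smul_apply, he1, smul_eq_mul, mul_one]
      linarith
  refine ⟨ball y₀ ε, isOpen_ball, mem_ball_self hε, Subset.rfl, ?_, ?_⟩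
  · -- convex, nonempty
    have hconv : Convex ℝ Ω := by
      have hΩ' : Ω = ball y₀ ε ∩ {y | y₀ (Fin.last n) < (EuclideanSpace.proj (Fin.last n) :
          EuclideanSpace ℝ (Fin (n + 1)) →L[ℝ] ℝ) y} := by
        ext y
        simp only [hΩ, mem_inter_iff, mem_setOf_eq, add_lt_add_iff_left]
        rfl
      rw [hΩ']
      exact (convex_ball y₀ ε).inter
        (convex_halfSpace_gt (EuclideanSpace.proj (Fin.last n) :
          EuclideanSpace ℝ (Fin (n + 1)) →L[ℝ] ℝ).isLinear _)
    exact hconv.isPathConnected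
      ⟨y₀ + (ε / 2) • e, hcurve _ ⟨by positivity, by linarith⟩⟩
  · -- closure
    have hcont : Continuous fun t : ℝ => y₀ + t • e :=
      continuous_const.add (continuous_id.smul continuous_const)
    have hlim : Tendsto (fun t : ℝ => y₀ + t • e) (𝓝[>] 0) (𝓝 y₀) := by
      have := hcont.tendsto 0
      rw [zero_smul, add_zero] at this
      exact this.mono_left nhdsWithin_le_nhds
    refine mem_closure_of_tendsto hlim ?_
    filter_upwards [Ioo_mem_nhdsGT hε] with t ht
    exact hcurve t ht

/-- **The local picture at an interior critical point of coindex `≥ 2`.** If `f` is a Morse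
function and `x` is an interior critical point of index `λ` with `λ + 2 ≤ dim M`, then `x`
adheres to `{f > f x}` and small neighbourhoods of `x` have their part above the level of `x`
path connected inside `{f > f x}`: in a Morse chart
(`Literature.Topology.FourManifolds.IsMorse.exists_chart_eq_quadratic_of_isInteriorPoint`, Milnor 1963, Lemma 2.2) this is
`Literature.Topology.FourManifolds.isPathConnected_quadraticModel`. These are exactly the
critical points at which passing the critical level does not merge two sheets of the
superlevel set (Milnor 1963, Thm. 3.2 and Remark 3.3: only handles of index `dim M - λ ≤ 1`
of `-f` can change `π₀`). [folklore] -/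
theorem localJoin_of_isMCriticalPt {f : M → ℝ} (hf : IsMorse I f) {x : M}
    (hx : I.IsInteriorPoint x) (hc : IsMCriticalPt I f x) (hk : morseIndex I f x + 2 ≤ n + 1) :
    x ∈ closure {y | f x < f y} ∧
    ∀ N ∈ 𝓝 x, ∃ U ∈ 𝓝 x, U ⊆ N ∧
      ∀ p ∈ U, ∀ q ∈ U, f x < f p → f x < f q → JoinedIn {y | f x < f y} p q := by
  obtain ⟨ψ, -, hxψ, hint, hquad⟩ := hf.exists_chart_eq_quadratic_of_isInteriorPoint hc hx
  set k : ℕ := morseIndex I f x with hkdef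
  set y₀ : EuclideanSpace ℝ (Fin (n + 1)) := I (ψ x) with hy₀
  -- the two blocks of the normal form
  set A : EuclideanSpace ℝ (Fin (n + 1)) → ℝ :=
    fun z => ∑ i ∈ Finset.univ.filter (fun i : Fin (n + 1) => i.val < k), z i ^ 2 with hA
  set B : EuclideanSpace ℝ (Fin (n + 1)) → ℝ :=
    fun z => ∑ i ∈ Finset.univ.filter (fun i : Fin (n + 1) => k ≤ i.val), z i ^ 2 with hB
  have hAc : Continuous A := by rw [hA]; fun_prop
  have hBc : Continuous B := by rw [hB]; fun_prop
  have hA0 : A 0 = 0 := by simp [hA]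
  have hB0 : B 0 = 0 := by simp [hB]
  set g : EuclideanSpace ℝ (Fin (n + 1)) → ℝ := fun y => f x - A (y - y₀) + B (y - y₀)
    with hgdef
  have hg : ∀ q ∈ ψ.source, f q = g (I (ψ q)) := fun q hq => by
    rw [hquad q hq, hgdef]
    simp only [hA, hB, PiLp.sub_apply]
  refine localJoin_of_chart ψ hxψ hint g hg fun ε hε => ?_
  set r : ℝ := ε / 2 with hr
  set a : ℝ := r / 4 with ha
  have hr0 : 0 < r := by positivity
  have ha0 : 0 < a := by positivity
  set Ω₀ : Set (EuclideanSpace ℝ (Fin (n + 1))) :=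
    {z | A z < a ^ 2 ∧ B z < r ^ 2 ∧ A z < B z} with hΩ₀
  set O : Set (EuclideanSpace ℝ (Fin (n + 1))) :=
    {y | A (y - y₀) < a ^ 2 ∧ B (y - y₀) < r ^ 2} with hO
  have hgy₀ : g y₀ = f x := by simp only [hgdef, sub_self, hA0, hB0]; ring
  have hΩ : {y ∈ O | g y₀ < g y} = (fun z => z + y₀) '' Ω₀ := by
    ext y
    simp only [hO, hΩ₀, mem_setOf_eq, mem_image, hgdef]
    constructor
    · rintro ⟨⟨h1, h2⟩, h3⟩
      exact ⟨y - y₀, ⟨h1, h2, by linarith⟩, sub_add_cancel y y₀⟩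
    · rintro ⟨z, ⟨h1, h2, h3⟩, rfl⟩
      simp only [add_sub_cancel_right]
      exact ⟨⟨h1, h2⟩, by linarith⟩
  have hsub : Continuous fun y : EuclideanSpace ℝ (Fin (n + 1)) => y - y₀ :=
    continuous_id.sub continuous_const
  refine ⟨O, ?_, ?_, ?_, ?_, ?_⟩
  · exact (isOpen_lt (hAc.comp hsub) continuous_const).inter
      (isOpen_lt (hBc.comp hsub) continuous_const)
  · show A (y₀ - y₀) < a ^ 2 ∧ B (y₀ - y₀) < r ^ 2
    rw [sub_self, hA0, hB0]
    exact ⟨by positivity, by positivity⟩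
  · rintro y ⟨h1, h2⟩
    rw [mem_ball, dist_eq_norm]
    have hsq : ‖y - y₀‖ ^ 2 < ε ^ 2 := by
      rw [← sum_sq_lt_add_sum_sq_le k]
      have h1' : A (y - y₀) < a ^ 2 := h1
      have h2' : B (y - y₀) < r ^ 2 := h2
      simp only [hA, hB] at h1' h2'
      have : a ^ 2 + r ^ 2 < ε ^ 2 := by rw [ha, hr]; nlinarith
      linarith
    exact lt_of_pow_lt_pow_left₀ 2 hε.le hsq
  · rw [hΩ]
    have hpc : IsPathConnected Ω₀ := isPathConnected_quadraticModel hk ha0 hr0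
    exact hpc.image (continuous_id.add continuous_const)
  · rw [hΩ]
    have h0 : (0 : EuclideanSpace ℝ (Fin (n + 1))) ∈ closure Ω₀ :=
      zero_mem_closure_quadraticModel hk ha0 hr0
    have := image_closure_subset_closure_image
      (f := fun z : EuclideanSpace ℝ (Fin (n + 1)) => z + y₀)
      (continuous_id.add continuous_const)
      (mem_image_of_mem (fun z : EuclideanSpace ℝ (Fin (n + 1)) => z + y₀) h0)
    rwa [zero_add] at this

/-- **The boundary of a compact connected manifold carrying a Morse function adapted to the
boundary without critical points of coindex `≤ 1` is connected and nonempty.** Let `M` be a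
compact connected smooth `(n+1)`-manifold with boundary (modelled on a slice model `I` on
`ℝⁿ⁺¹`, e.g. `𝓡∂ (n + 1)`, `n ≥ 1`) and `f : M → ℝ` a Morse function adapted to
`∂M` (`Literature.Topology.FourManifolds.IsMorseAdapted`: `f ≡ 1` and regular on `∂M`, `f < 1` inside) all of whose critical
points have index `λ ≤ n - 1`. Then `∂M = f⁻¹(1)` is preconnected and nonempty. Dually
(`1 - f`), `M` is `∂M × [0, 1]` with handles of index `n + 1 - λ ≥ 2` attached (Milnor,
*Morse theory* (1963), Thms. 3.1–3.2; Milnor, *Lectures on the h-cobordism theorem* (1965),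
Thm. 3.12), and handles of index `≥ 2` have connected attaching spheres, so
`π₀(∂M) ≅ π₀(M)`; the proof here is elementary
(`Literature.Topology.FourManifolds.isPreconnected_preimage_top_of_joinedIn` with the local
pictures `Literature.Topology.FourManifolds.localJoin_of_not_isMCriticalPt`, `Literature.Topology.FourManifolds.localJoin_of_isMCriticalPt`; the maximum
of `f` is not attained at an interior point, which would be critical of index `n + 1`).
[folklore] -/
theorem IsMorseAdapted.isPreconnected_boundary_and_nonempty [SliceModel I] [T2Space M]
    [CompactSpace M] [ConnectedSpace M] [LocallyPathConnectedSpace M] {f : M → ℝ}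
    (hf : IsMorseAdapted I f)
    (hidx : ∀ x, I.IsInteriorPoint x → IsMCriticalPt I f x → morseIndex I f x + 2 ≤ n + 1) :
    IsPreconnected (I.boundary M) ∧ (I.boundary M).Nonempty := by
  have hcont : Continuous f := hf.1.1.continuous
  have hint_of_lt : ∀ x, f x < 1 → I.IsInteriorPoint x := fun x hx => by
    rcases I.isInteriorPoint_or_isBoundaryPoint x with h | h
    · exact h
    · exact absurd (hf.2.1 x h).1 hx.ne
  have h1 : ∀ x, f x ≤ 1 := fun x => by
    rcases I.isInteriorPoint_or_isBoundaryPoint x with h | h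
    · exact (hf.2.2 x h).le
    · exact (hf.2.1 x h).1.le
  have hLH : ∀ x, f x < 1 → (x ∈ closure {y | f x < f y} ∧
      ∀ N ∈ 𝓝 x, ∃ U ∈ 𝓝 x, U ⊆ N ∧
        ∀ p ∈ U, ∀ q ∈ U, f x < f p → f x < f q → JoinedIn {y | f x < f y} p q) := by
    intro x hx
    by_cases hc : IsMCriticalPt I f x
    · exact localJoin_of_isMCriticalPt hf.1 (hint_of_lt x hx) hc (hidx x (hint_of_lt x hx) hc)
    · exact localJoin_of_not_isMCriticalPt hf.1.1 (hint_of_lt x hx) hc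
  have hbd : I.boundary M = f ⁻¹' {1} := by
    ext x
    constructor
    · intro hx
      exact (hf.2.1 x hx).1
    · intro hx
      by_contra hb
      have hi : I.IsInteriorPoint x := (I.isInteriorPoint_iff_not_isBoundaryPoint x).2 hb
      exact (hf.2.2 x hi).ne hx
  rw [hbd]
  constructor
  · exact isPreconnected_preimage_top_of_joinedIn hcont h1 (fun x hx => (hLH x hx).1)
      fun x hx => (hLH x hx).2
  · obtain ⟨x, -, hx⟩ := isCompact_univ.exists_isMaxOn univ_nonempty hcont.continuousOn
    refine ⟨x, ?_⟩
    show f x = 1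
    by_contra hne
    have hlt : f x < 1 := lt_of_le_of_ne (h1 x) hne
    have hcl := (hLH x hlt).1
    have hempty : {y | f x < f y} = ∅ :=
      eq_empty_of_forall_notMem fun y hy => not_lt.2 (hx (mem_univ y)) (mem_setOf_eq ▸ hy)
    rw [hempty, closure_empty] at hcl
    exact hcl

end LocalMorse

/-! ### Discharge: the boundary of a handlebody is connected -/

section Discharge

/-- **The boundary of a handlebody is connected (and nonempty)** — discharge of the named fact
`Literature.Topology.FourManifolds.IsHandlebody.connectedSpace_boundary` (`LickorishWallace.lean`, F2a; Juhász,
*Differential and Low-Dimensional Topology* (2023), §3.5, p. 96: "a genus `g` handlebody is a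
three-ball with `g` oriented one-handles attached", and Def. 3.27: the Heegaard surface
`Σ = ∂H_α` is "a closed, connected, and oriented surface"; Schultens (2014), Def. 6.1.5).
Proof: a genus-`g` handlebody carries a Morse function adapted to its boundary with one critical
point of index `0`, `g` of index `1` and none of index `2` or `3` (`Literature.Topology.FourManifolds.IsHandlebody`,
`Literature.Topology.FourManifolds.HasHandleDecomposition`, the critical set being finite by
`Literature.Topology.FourManifolds.IsMorse.finite_criticalSet_holds`), so every critical point has coindex `≥ 2` and
`Literature.Topology.FourManifolds.IsMorseAdapted.isPreconnected_boundary_and_nonempty` applies; the boundary datum `b`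
identifies `b.carrier` with `∂H` through the embedding `b.incl`.
[cite: Juhasz2023, §3.5 (p. 96) and Def. 3.27] -/
theorem IsHandlebody.connectedSpace_boundary_holds : IsHandlebody.connectedSpace_boundary.{u} := by
  intro g H _ _ _ _ _ hH b
  haveI := hH.compactSpace
  haveI := hH.connectedSpace
  haveI : LocallyPathConnectedSpace H :=
    ChartedSpace.locallyPathConnectedSpace (EuclideanHalfSpace 3) H
  obtain ⟨f, hf, hcount⟩ := hH.hasHandleDecomposition
  have hfin : (criticalSet (𝓡∂ 3) f).Finite := IsMorse.finite_criticalSet_holds hf.isMorse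
  have hidx : ∀ x, (𝓡∂ 3).IsInteriorPoint x → IsMCriticalPt (𝓡∂ 3) f x →
      morseIndex (𝓡∂ 3) f x + 2 ≤ 2 + 1 := by
    intro x _ hx
    by_contra hk
    have hk2 : 2 ≤ morseIndex (𝓡∂ 3) f x := by omega
    have hmem : x ∈ criticalSetOfIndex (𝓡∂ 3) f (morseIndex (𝓡∂ 3) f x) := ⟨hx, rfl⟩
    have hfin' : (criticalSetOfIndex (𝓡∂ 3) f (morseIndex (𝓡∂ 3) f x)).Finite :=
      hfin.subset (criticalSetOfIndex_subset _ f _)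
    have h0 : (criticalSetOfIndex (𝓡∂ 3) f (morseIndex (𝓡∂ 3) f x)).ncard = 0 := by
      rw [hcount, handleCount_of_two_le _ _ hk2]
    rw [Set.ncard_eq_zero hfin'] at h0
    rw [h0] at hmem
    exact hmem
  obtain ⟨hpre, hne⟩ := hf.isPreconnected_boundary_and_nonempty hidx
  have hrange := b.range_incl
  have hind : Topology.IsInducing b.incl := b.isSmoothEmbedding.isEmbedding.isInducing
  rw [connectedSpace_iff_univ]
  refine ⟨?_, ?_⟩
  · obtain ⟨y, hy⟩ := hne
    rw [← hrange] at hy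
    obtain ⟨c, rfl⟩ := hy
    exact ⟨c, mem_univ c⟩
  · rw [← hind.isPreconnected_image, image_univ, hrange]
    exact hpre

end Discharge

end Literature.Topology.FourManifolds
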